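import Mathlib
import Summits.ValiantsHypothesis.ValiantsHypothesis.Theorems.ValuativeGCTValuativeFlipSliceBound

/-!
# Four-row normal form (det side of the four-row count, part 1 of 2)

Helper file for stub `stub_fourRowSliceBound` of line `four-row-count`, crux
`ValuativeGCT.ValuativeFlip` (stmt-ValiantsHypothesis-12624).  The four KEPT row slots of
`A ∈ End W` (`N² ≤ idx j + 4`, `N = m + 2`) are `frsJ m 0, …, frsJ m 3`; a generic 4-tuple of slots
`(R₁, R₂, R₃, R₄)` is moved by a unimodular row-wise sandwich `R ↦ P R Q` (`det P = det Q = 1`)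
into the normal form `R₁ = u₀·1`, `R₂ = u₁·shift + (last column)`, `(R₃)₀₁ = u₁`:
first the Krylov normal form of B1 (`P = aK⁻¹`, `Q = b adj(R₁) K`, `K = Kry(R₂ adj R₁)`), then the
unimodular torus pair `(c D(t)⁻¹, c⁻¹ D(t))`, `D(t) = diag(tⁱ)`, `t² = u₁ / (R₃)₀₁`.  Genericity is
`h = det R₁ · det K · (adj K · R₃ · adj R₁ · K)₀₁ ≠ 0` (`h = 1` at `(1, shift, all-ones, 1)`).
Everything is elementary linear algebra over `ℂ`; no named facts are used.
-/

set_option linter.dupNamespace false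

namespace Summit.ValiantsHypothesis.ValiantsHypothesis.Theorems.ValuativeFlip

open MvPolynomial
open scoped BigOperators Matrix
open Literature.NumberTheory.DiophantineGeometry

noncomputable section

variable (m : ℕ)

/-- The row-major index `N² - 1 - k` of the `k`-th kept slot from the end is a valid index.
[folklore] -/
theorem frs_idx_lt (k : Fin 4) : (m + 2) * (m + 2) - 1 - (k : ℕ) < (m + 2) * (m + 2) := by
  have h4 : 4 ≤ (m + 2) * (m + 2) := by nlinarith
  omega

/-- The `k`-th kept row slot from the end (`k < 4`): the slot of row-major index `N² - 1 - k`,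
`N = m + 2`. [folklore] -/
def frsJ (k : Fin 4) : MatIdx (m + 2) :=
  matIdxEquiv (m + 2) ⟨(m + 2) * (m + 2) - 1 - (k : ℕ), frs_idx_lt m k⟩

/-- Row-major index of the `k`-th kept slot. [folklore] -/
theorem frs_symm_frsJ (k : Fin 4) :
    (((matIdxEquiv (m + 2)).symm (frsJ m k) : Fin ((m + 2) * (m + 2))) : ℕ) =
      (m + 2) * (m + 2) - 1 - (k : ℕ) := by
  simp only [frsJ, OrderIso.symm_apply_apply]

/-- The four kept slots are pairwise distinct. [folklore] -/
theorem frsJ_injective : Function.Injective (frsJ m) := by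
  intro k k' h
  have h' := congrArg (fun j => (((matIdxEquiv (m + 2)).symm j : Fin ((m + 2) * (m + 2))) : ℕ)) h
  simp only [frs_symm_frsJ] at h'
  have h4 : 4 ≤ (m + 2) * (m + 2) := by nlinarith
  exact Fin.ext (by omega)

/-- `frsJ m k ≠ frsJ m k'` for `k ≠ k'`. [folklore] -/
theorem frsJ_ne {k k' : Fin 4} (h : k ≠ k') : frsJ m k ≠ frsJ m k' :=
  fun e => h (frsJ_injective m e)

/-- A row slot is kept (`N² ≤ idx + 4`) iff it is one of the four slots `frsJ m k`. [folklore] -/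
theorem frs_kept_iff (j : MatIdx (m + 2)) :
    (m + 2) * (m + 2) ≤ (((matIdxEquiv (m + 2)).symm j : Fin ((m + 2) * (m + 2))) : ℕ) + 4 ↔
      ∃ k : Fin 4, frsJ m k = j := by
  constructor
  · intro hj
    set i := (matIdxEquiv (m + 2)).symm j with hi
    have hi2 : (i : ℕ) < (m + 2) * (m + 2) := i.2
    refine ⟨⟨(m + 2) * (m + 2) - 1 - (i : ℕ), by omega⟩, ?_⟩
    have : frsJ m ⟨(m + 2) * (m + 2) - 1 - (i : ℕ), by omega⟩ = matIdxEquiv (m + 2) i := by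
      simp only [frsJ]
      congr 1
      exact Fin.ext (by simp only; omega)
    rw [this, hi, OrderIso.apply_symm_apply]
  · rintro ⟨k, rfl⟩
    rw [frs_symm_frsJ]
    have h4 : 4 ≤ (m + 2) * (m + 2) := by nlinarith
    omega

/-- The generic slot `k`: the matrix of variables `X (frsJ m k, ·)`. [folklore] -/
def frsXslot (k : Fin 4) :
    Matrix (Fin (m + 2)) (Fin (m + 2)) (MvPolynomial (MatIdx (m + 2) × MatIdx (m + 2)) ℂ) :=
  sbSlot (fun p => X p) (frsJ m k)

/-- The generic slots evaluate to the slots. [folklore] -/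
theorem frsXslot_map_eval (x : MatIdx (m + 2) × MatIdx (m + 2) → ℂ) (k : Fin 4) :
    (frsXslot m k).map (eval x) = sbSlot x (frsJ m k) :=
  sbSlot_map_eval x (frsJ m k)

/-- The density polynomial
`h = det X_{j₀} · det K · (adj K · X_{j₂} · adj X_{j₀} · K)₀₁`, `K = Kry(X_{j₁} adj X_{j₀})`. [folklore] -/
def frsH : MvPolynomial (MatIdx (m + 2) × MatIdx (m + 2)) ℂ :=
  (frsXslot m 0).det *
    (sbKry (frsXslot m 1 * (frsXslot m 0).adjugate)).det *
      ((sbKry (frsXslot m 1 * (frsXslot m 0).adjugate)).adjugate * frsXslot m 2 *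
        (frsXslot m 0).adjugate * sbKry (frsXslot m 1 * (frsXslot m 0).adjugate)) 0 1

/-- Evaluation of the density polynomial. [folklore] -/
theorem eval_frsH (x : MatIdx (m + 2) × MatIdx (m + 2) → ℂ) :
    eval x (frsH m) = (sbSlot x (frsJ m 0)).det *
      (sbKry (sbSlot x (frsJ m 1) * (sbSlot x (frsJ m 0)).adjugate)).det *
        ((sbKry (sbSlot x (frsJ m 1) * (sbSlot x (frsJ m 0)).adjugate)).adjugate *
          sbSlot x (frsJ m 2) * (sbSlot x (frsJ m 0)).adjugate *
            sbKry (sbSlot x (frsJ m 1) * (sbSlot x (frsJ m 0)).adjugate)) 0 1 := by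
  have hA : ∀ k, (RingHom.mapMatrix (eval x)) (frsXslot m k) = sbSlot x (frsJ m k) := fun k => by
    rw [RingHom.mapMatrix_apply, frsXslot_map_eval]
  have hadj : (RingHom.mapMatrix (eval x)) (frsXslot m 0).adjugate = (sbSlot x (frsJ m 0)).adjugate := by
    rw [RingHom.map_adjugate, hA]
  have hK : (RingHom.mapMatrix (eval x)) (sbKry (frsXslot m 1 * (frsXslot m 0).adjugate)) =
      sbKry (sbSlot x (frsJ m 1) * (sbSlot x (frsJ m 0)).adjugate) := by
    rw [RingHom.mapMatrix_apply, sbKry_map, ← RingHom.mapMatrix_apply, map_mul, hA, hadj]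
  have hKadj : (RingHom.mapMatrix (eval x)) (sbKry (frsXslot m 1 * (frsXslot m 0).adjugate)).adjugate =
      (sbKry (sbSlot x (frsJ m 1) * (sbSlot x (frsJ m 0)).adjugate)).adjugate := by
    rw [RingHom.map_adjugate, hK]
  have hentry : ∀ M : Matrix (Fin (m + 2)) (Fin (m + 2)) (MvPolynomial (MatIdx (m + 2) × MatIdx (m + 2)) ℂ),
      eval x (M 0 1) = (RingHom.mapMatrix (eval x) M) 0 1 := fun M => by
    rw [RingHom.mapMatrix_apply, Matrix.map_apply]
  simp only [frsH, map_mul, RingHom.map_det, hentry, hA, hK, hKadj, hadj]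

/-- The test point: slot `j₁` is the shift, slot `j₂` is the all-ones matrix, all other slots are
the identity. [folklore] -/
def frsTest : MatIdx (m + 2) × MatIdx (m + 2) → ℂ :=
  fun p => (if p.1 = frsJ m 1 then sbShift ℂ (m + 2)
    else if p.1 = frsJ m 2 then Matrix.of (fun _ _ => (1 : ℂ))
    else (1 : Matrix (Fin (m + 2)) (Fin (m + 2)) ℂ)) (ofLex p.2).1 (ofLex p.2).2

/-- Slots of the test point. [folklore] -/
theorem sbSlot_frsTest (j : MatIdx (m + 2)) :
    sbSlot (frsTest m) j = if j = frsJ m 1 then sbShift ℂ (m + 2)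
      else if j = frsJ m 2 then Matrix.of (fun _ _ => (1 : ℂ)) else 1 := by
  ext c d
  simp only [sbSlot, frsTest, Matrix.of_apply, ofLex_toLex]

/-- The density polynomial is nonzero: it is `1` at the test point. [folklore] -/
theorem frsH_ne_zero : frsH m ≠ 0 := fun h => by
  have := eval_frsH m (frsTest m)
  rw [h, map_zero, sbSlot_frsTest, sbSlot_frsTest, sbSlot_frsTest,
    if_neg (frsJ_ne m (by decide : (0 : Fin 4) ≠ 1)), if_neg (frsJ_ne m (by decide : (0 : Fin 4) ≠ 2)),
    if_pos rfl, if_neg (frsJ_ne m (by decide : (2 : Fin 4) ≠ 1)), if_pos rfl,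
    Matrix.adjugate_one, Matrix.mul_one, sbKry_shift] at this
  simp at this

/-- Scalars rescaling a matrix to a unimodular one are nonzero. [folklore] -/
theorem frs_ne_zero_of_smul_det_one {a : ℂ} {M : Matrix (Fin (m + 2)) (Fin (m + 2)) ℂ}
    (h : (a • M).det = 1) : a ≠ 0 := by
  rintro rfl
  rw [Matrix.det_smul, Fintype.card_fin, zero_pow (by omega), zero_mul] at h
  exact zero_ne_one h

/-- **Krylov step.** For generic `x` (`h(x) ≠ 0`) the unimodular pair `P = a K⁻¹`,
`Q = b adj(x_{j₀}) K` (`K` the Krylov matrix of `x_{j₁} adj x_{j₀}`) makes slot `j₀` scalar and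
slot `j₁` equal to `u₁ = ab ≠ 0` times a companion matrix, and keeps entry `(0,1)` of slot `j₂`
nonzero. [folklore: Krylov normal form; B1 `sb_exists_unimodular`] -/
theorem frs_krylov (x : MatIdx (m + 2) × MatIdx (m + 2) → ℂ) (hx : eval x (frsH m) ≠ 0) :
    ∃ P Q : Matrix (Fin (m + 2)) (Fin (m + 2)) ℂ, P.det = 1 ∧ Q.det = 1 ∧
      ∃ u₀ u₁ : ℂ, u₁ ≠ 0 ∧ sbSlot (sbSand P Q x) (frsJ m 2) 0 1 ≠ 0 ∧
        sbSlot (sbSand P Q x) (frsJ m 0) = u₀ • (1 : Matrix (Fin (m + 2)) (Fin (m + 2)) ℂ) ∧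
        ∀ c d : Fin (m + 2), (d : ℕ) + 1 < m + 2 →
          sbSlot (sbSand P Q x) (frsJ m 1) c d = if (c : ℕ) = d + 1 then u₁ else 0 := by
  rw [eval_frsH] at hx
  set A₀ := sbSlot x (frsJ m 0) with hA₀
  set A₁ := sbSlot x (frsJ m 1) with hA₁
  set A₂ := sbSlot x (frsJ m 2) with hA₂
  set K := sbKry (A₁ * A₀.adjugate) with hK
  have hd : A₀.det ≠ 0 := left_ne_zero_of_mul (left_ne_zero_of_mul hx)
  have hKd : K.det ≠ 0 := right_ne_zero_of_mul (left_ne_zero_of_mul hx)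
  have hr : (K.adjugate * A₂ * A₀.adjugate * K) 0 1 ≠ 0 := right_ne_zero_of_mul hx
  obtain ⟨a, haP⟩ := sb_exists_smul_det_one m K⁻¹ (by
    rw [Matrix.det_nonsing_inv, Ring.inverse_eq_inv']
    exact inv_ne_zero hKd)
  obtain ⟨b, hbQ⟩ := sb_exists_smul_det_one m (A₀.adjugate * K) (by
    rw [Matrix.det_mul, Matrix.det_adjugate]
    exact mul_ne_zero (pow_ne_zero _ hd) hKd)
  have ha : a ≠ 0 := frs_ne_zero_of_smul_det_one m haP
  have hb : b ≠ 0 := frs_ne_zero_of_smul_det_one m hbQ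
  refine ⟨a • K⁻¹, b • (A₀.adjugate * K), haP, hbQ, a * b * A₀.det, a * b, mul_ne_zero ha hb,
    ?_, ?_, fun c d hd1 => ?_⟩
  · -- entry `(0,1)` of slot `j₂` is `a b (det K)⁻¹ (adj K · A₂ · adj A₀ · K)₀₁ ≠ 0`
    rw [sbSlot_sbSand, ← hA₂, Matrix.inv_def, Ring.inverse_eq_inv', smul_smul, Matrix.smul_mul,
      Matrix.smul_mul, Matrix.mul_smul, smul_smul, Matrix.smul_apply, smul_eq_mul,
      ← Matrix.mul_assoc]
    exact mul_ne_zero (mul_ne_zero (mul_ne_zero ha (inv_ne_zero hKd)) hb) hr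
  · rw [sbSlot_sbSand, ← hA₀, Matrix.smul_mul, Matrix.mul_smul, Matrix.smul_mul, smul_smul,
      Matrix.mul_assoc, ← Matrix.mul_assoc A₀, Matrix.mul_adjugate, Matrix.smul_mul, Matrix.one_mul,
      Matrix.mul_smul, Matrix.nonsing_inv_mul _ (isUnit_iff_ne_zero.mpr hKd), smul_smul]
    ring_nf
  · have h1 : sbSlot (sbSand (a • K⁻¹) (b • (A₀.adjugate * K)) x) (frsJ m 1) =
        (a * b) • (K⁻¹ * (A₁ * A₀.adjugate) * K) := by
      rw [sbSlot_sbSand, ← hA₁, Matrix.smul_mul, Matrix.mul_smul, Matrix.smul_mul, smul_smul,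
        mul_comm b a]
      simp only [Matrix.mul_assoc]
    rw [h1, Matrix.smul_apply, hK, sbKry_conj_apply _ (hK ▸ hKd) c d hd1]
    simp

/-- The torus element `D(t) = diag(1, t, t², …)`. [folklore] -/
def frsD (t : ℂ) : Matrix (Fin (m + 2)) (Fin (m + 2)) ℂ :=
  Matrix.diagonal fun i => t ^ (i : ℕ)

/-- `D(t⁻¹) D(t) = 1` for `t ≠ 0`. [folklore] -/
theorem frsD_inv_mul {t : ℂ} (ht : t ≠ 0) : frsD m t⁻¹ * frsD m t = 1 := by
  rw [frsD, frsD, Matrix.diagonal_mul_diagonal, ← Matrix.diagonal_one]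
  congr 1
  funext i
  rw [← mul_pow, inv_mul_cancel₀ ht, one_pow]

/-- `det D(t) ≠ 0` for `t ≠ 0`. [folklore] -/
theorem det_frsD_ne_zero {t : ℂ} (ht : t ≠ 0) : (frsD m t).det ≠ 0 := by
  rw [frsD, Matrix.det_diagonal]
  exact Finset.prod_ne_zero_iff.mpr fun i _ => pow_ne_zero _ ht

/-- `det D(t⁻¹) = (det D(t))⁻¹`. [folklore] -/
theorem det_frsD_inv (t : ℂ) : (frsD m t⁻¹).det = ((frsD m t).det)⁻¹ := by
  rw [frsD, frsD, Matrix.det_diagonal, Matrix.det_diagonal, ← Finset.prod_inv_distrib]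
  exact Finset.prod_congr rfl fun i _ => inv_pow t i

/-- Entries of the torus conjugate `D(t⁻¹) M D(t)`. [folklore] -/
theorem frsD_conj_apply (t : ℂ) (M : Matrix (Fin (m + 2)) (Fin (m + 2)) ℂ) (e f : Fin (m + 2)) :
    (frsD m t⁻¹ * M * frsD m t) e f = t⁻¹ ^ (e : ℕ) * M e f * t ^ (f : ℕ) := by
  rw [frsD, frsD, Matrix.mul_diagonal, Matrix.diagonal_mul]

/-- A unimodular rescaling of the torus pair acts by plain conjugation. [folklore] -/
theorem frs_smul_conj {c : ℂ} (hc : c ≠ 0) (D' M D : Matrix (Fin (m + 2)) (Fin (m + 2)) ℂ) :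
    c • D' * M * (c⁻¹ • D) = D' * M * D := by
  rw [Matrix.smul_mul, Matrix.smul_mul, Matrix.mul_smul, smul_smul, mul_inv_cancel₀ hc, one_smul]

/-- **Torus step.** If slot `j₀` is scalar, slot `j₁` is `u₁ ≠ 0` times a companion matrix and
entry `(0,1)` of slot `j₂` is `r ≠ 0`, then the unimodular pair `(c D(t)⁻¹, c⁻¹ D(t))` with
`t² = u₁ / r`, `c^N = det D(t)` keeps slot `j₀`, rescales the subdiagonal of slot `j₁` to
`u₁' = u₁ t⁻¹` and moves entry `(0,1)` of slot `j₂` to the same value `u₁'`. [folklore] -/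
theorem frs_torus (y : MatIdx (m + 2) × MatIdx (m + 2) → ℂ) (u₀ u₁ : ℂ) (hu₁ : u₁ ≠ 0)
    (hr : sbSlot y (frsJ m 2) 0 1 ≠ 0)
    (hy0 : sbSlot y (frsJ m 0) = u₀ • (1 : Matrix (Fin (m + 2)) (Fin (m + 2)) ℂ))
    (hy1 : ∀ c d : Fin (m + 2), (d : ℕ) + 1 < m + 2 →
      sbSlot y (frsJ m 1) c d = if (c : ℕ) = d + 1 then u₁ else 0) :
    ∃ P Q : Matrix (Fin (m + 2)) (Fin (m + 2)) ℂ, P.det = 1 ∧ Q.det = 1 ∧ ∃ u₁' : ℂ,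
      sbSlot (sbSand P Q y) (frsJ m 0) = u₀ • (1 : Matrix (Fin (m + 2)) (Fin (m + 2)) ℂ) ∧
      (∀ c d : Fin (m + 2), (d : ℕ) + 1 < m + 2 →
        sbSlot (sbSand P Q y) (frsJ m 1) c d = if (c : ℕ) = d + 1 then u₁' else 0) ∧
      sbSlot (sbSand P Q y) (frsJ m 2) 0 1 = u₁' := by
  set r := sbSlot y (frsJ m 2) 0 1 with hr_def
  obtain ⟨t, ht2⟩ := IsAlgClosed.exists_pow_nat_eq (u₁ / r) (show 0 < 2 by norm_num)
  have ht : t ≠ 0 := by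
    rintro rfl
    rw [zero_pow two_ne_zero] at ht2
    exact div_ne_zero hu₁ hr ht2.symm
  obtain ⟨c, hc⟩ := IsAlgClosed.exists_pow_nat_eq (frsD m t).det (show 0 < m + 2 by omega)
  have hc0 : c ≠ 0 := by
    rintro rfl
    rw [zero_pow (by omega)] at hc
    exact det_frsD_ne_zero m ht hc.symm
  refine ⟨c • frsD m t⁻¹, c⁻¹ • frsD m t, ?_, ?_, u₁ * t⁻¹, ?_, fun c' d hd1 => ?_, ?_⟩
  · rw [Matrix.det_smul, Fintype.card_fin, hc, det_frsD_inv, mul_inv_cancel₀ (det_frsD_ne_zero m ht)]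
  · rw [Matrix.det_smul, Fintype.card_fin, inv_pow, hc, inv_mul_cancel₀ (det_frsD_ne_zero m ht)]
  · rw [sbSlot_sbSand, frs_smul_conj m hc0, hy0, Matrix.mul_smul, Matrix.mul_one, Matrix.smul_mul,
      frsD_inv_mul m ht]
  · rw [sbSlot_sbSand, frs_smul_conj m hc0, frsD_conj_apply, hy1 c' d hd1]
    split_ifs with hcd
    · rw [hcd, pow_succ]
      have h1 : t⁻¹ ^ (d : ℕ) * t ^ (d : ℕ) = 1 := by rw [← mul_pow, inv_mul_cancel₀ ht, one_pow]
      linear_combination (u₁ * t⁻¹) * h1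
    · rw [mul_zero, zero_mul]
  · rw [sbSlot_sbSand, frs_smul_conj m hc0, frsD_conj_apply, ← hr_def]
    have hrt : r * t ^ 2 = u₁ := by
      rw [ht2]
      field_simp
    simp only [Fin.val_zero, pow_zero, one_mul, Fin.val_one, pow_one]
    rw [eq_mul_inv_iff_mul_eq₀ ht, ← hrt]
    ring

/-- Composition of two sandwiches. [folklore] -/
theorem sbSand_sbSand {N : ℕ} (P₁ Q₁ P₂ Q₂ : Matrix (Fin N) (Fin N) ℂ) (x : MatIdx N × MatIdx N → ℂ) :
    sbSand P₂ Q₂ (sbSand P₁ Q₁ x) = sbSand (P₂ * P₁) (Q₁ * Q₂) x := by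
  funext p
  show (P₂ * sbSlot (sbSand P₁ Q₁ x) p.1 * Q₂) (ofLex p.2).1 (ofLex p.2).2 =
    (P₂ * P₁ * sbSlot x p.1 * (Q₁ * Q₂)) (ofLex p.2).1 (ofLex p.2).2
  rw [sbSlot_sbSand]
  simp only [Matrix.mul_assoc]

/-- **Four-row normal form** (wall-breaker k3 helper for stub `stub_fourRowSliceBound`; Krylov step
then torus step).  For a generic point `x` (`h(x) ≠ 0`) there is a unimodular row-wise sandwich
`(P, Q)` after which slot `j₀` is the scalar `u₀ • 1`, slot `j₁` has constant subdiagonal `u₁`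
(its first `N - 1` columns are `u₁ e₂, …, u₁ e_N`) and entry `(0,1)` of slot `j₂` equals the
same `u₁`. [folklore: Krylov / rational canonical form + torus normalisation] -/
theorem fourRowNormalForm (m : ℕ) (x : MatIdx (m + 2) × MatIdx (m + 2) → ℂ) (hx : MvPolynomial.eval x (frsH m) ≠ 0) : ∃ P Q : Matrix (Fin (m + 2)) (Fin (m + 2)) ℂ, P.det = 1 ∧ Q.det = 1 ∧ ∃ u₀ u₁ : ℂ, sbSlot (sbSand P Q x) (frsJ m 0) = u₀ • (1 : Matrix (Fin (m + 2)) (Fin (m + 2)) ℂ) ∧ (∀ c d : Fin (m + 2), (d : ℕ) + 1 < m + 2 → sbSlot (sbSand P Q x) (frsJ m 1) c d = if (c : ℕ) = d + 1 then u₁ else 0) ∧ sbSlot (sbSand P Q x) (frsJ m 2) 0 1 = u₁ := by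
  obtain ⟨P₁, Q₁, hP₁, hQ₁, u₀, u₁, hu₁, hr, hy0, hy1⟩ := frs_krylov m x hx
  obtain ⟨P₂, Q₂, hP₂, hQ₂, u₁', hz0, hz1, hz2⟩ :=
    frs_torus m (sbSand P₁ Q₁ x) u₀ u₁ hu₁ hr hy0 hy1
  refine ⟨P₂ * P₁, Q₁ * Q₂, by rw [Matrix.det_mul, hP₂, hP₁, one_mul],
    by rw [Matrix.det_mul, hQ₁, hQ₂, one_mul], u₀, u₁', ?_⟩
  rw [← sbSand_sbSand]
  exact ⟨hz0, hz1, hz2⟩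

end

end Summit.ValiantsHypothesis.ValiantsHypothesis.Theorems.ValuativeFlip
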